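import Literature.NumberTheory.EllipticCurves.Kobayashi2003.SignedColemanKatoZeta
import Literature.NumberTheory.EllipticCurves.KuriharaNumberInvariants
import Literature.NumberTheory.EllipticCurves.Isogeny
import Literature.NumberTheory.EllipticCurves.Tamagawa
import HarnessLib

/-!
# Castella–Sano (arXiv:2601.14504, PREPRINT 2026), Thm. 1 (i) ⟹ (ii) AT THE TRIVIAL CHARACTER: Kim's
# Tamagawa-defect identity `∂^{(∞)}(δ̃) = ord_p Tam_E` gives KATO'S MAIN CONJECTURE for `T_pE` over `ℚ_∞`
# — read on the pinned objects of Kobayashi's `η = 1` Coleman/Kato package, as an explicitly labelled OPEN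
# hypothesis (nothing asserted; NEVER a theorem)

Topic `NumberTheory/EllipticCurves`, sub-directory `CastellaSano2026` (namespace = path). HONEST FRAMING: an
UNREFEREED preprint enters the tree only as an explicitly labelled OPEN hypothesis (`[claim: …, status:
under-review]`), NEVER as a theorem; nothing here is asserted about any curve; nothing is booked; BSD is not
proved by any of this. Pattern of `FouquetWan2021/KatoMainConjecturePPartOPEN.lean` and of the accepted
composite binder `CastellaSano2026_thm1_via_kobayashi74_OPEN`
(`Summits/BirchSwinnertonDyer/Rank1Residual/Supersingular/KobayashiMainConjectureKuriharaRigidity.lean`,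
p606756), whose Kobayashi-Thm-7.4 half THIS file lets the kernel discharge: the binder below is the
Castella–Sano half ALONE, stated on Kato's objects exactly like its published `t = 0` companion
`Kim2026.thm111_katoMainIdentity_of_kuriharaNumber_ne_zero` (same frame, same conclusion). Written for the
cell `bsd-ssimc` (HOME `run/shared/lean/pub/bsd-ssimc/`), seat `bsd-line-slh-p1-w2`, route `SignedLowerHalves`,
crux item stmt-BirchSwinnertonDyer-19001 `KobayashiLowerHalfLargeImage`, line `kurihara_rigidity` (engine B
`stub_signedMC_of_kimTamagawaDefect`, reshape r2). Consumer (kernel, Summits-side):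
`Theorems/SignedLowerHalvesKobayashiLowerHalfLargeImageKuriharaRigidityThm74.lean`
(`KuriharaRigidity.kobayashiMainConjecture_of_katoMainConjectureFrame`).

## Source, verbatim (F. Castella, T. Sano, *On refined nonvanishing conjectures by Kurihara and
## Kolyvagin*, arXiv:2601.14504 v1 (2026); held text `paper:arxiv-2601.14504`, page = file number;
## FRESHNESS 2026-08-28: arXiv only, no journal record)

§1.1.1 (p0003): "Let `E/ℚ` be an elliptic curve of conductor `N` without complex multiplication, and fix an
odd prime `p` such that (sur) `ρ̄ : G_ℚ → Aut_{𝔽_p}(E[p])` is surjective. … `𝓛 := {ℓ : ℓ ≡ 1 (mod p), ℓ ∤ N,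
a_ℓ ≡ ℓ + 1 (mod p)}` … `𝒩` the collection of all squarefree products of primes `ℓ ∈ 𝓛` … Let `f ∈ S₂(Γ₀(N))`
be the newform attached to `E`. Let `Ω_E^+ = ∫_{E(ℝ)} ω_E` be the positive Néron period of `E` … Fix a modular
parametrization `φ : X₀(N) → E` and let `c_φ ∈ ℤ` be the associated Manin constant … Assume that `p ∤ c_φ`.
(For instance, if `E` is the strong Weil curve … then (manin) holds provided `p² ∤ N` by [mazur].) …
`δ_n := ∑_{a=1,(a,n)=1}^n \overline{[a/n]} (∏_{ℓ∣n} log_{𝔽_ℓ}(a)) ∈ ℤ/I_n`, where `[a/n] = Re(2πi ∫_∞^{a/n}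
f(z)dz)/Ω_E^+ ∈ ℚ`". §1.1.3 (p0003–p0004): "`𝓜(n) := max{𝓜 ≥ 0 : δ_n ∈ p^𝓜 ℤ/I_n}` (`∞` if `δ_n = 0`) …
`𝓜_r := min{𝓜(n) : n ∈ 𝒩, ν(n) = r}` … `𝓜_r ≥ 𝓜_{r+2} ≥ 0` … `𝓜_∞(δ) := lim_{r→∞, (−1)^r = ε} 𝓜_r` …
**Conjecture 2 (Refined Kurihara's conjecture).** Let `p > 3` be a prime such that (sur) and (manin) both
hold. Then `𝓜_∞(δ) = ord_p(Tam_E)`." (`Tam_E := ∏_{ℓ∣N} c_ℓ`, §1.1.2; "formulated in [kim]" = C.-H. Kim's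
Conjecture 1.10, `∂^{(∞)}(δ̃) = ∑_{ℓ∣N} ord_p c_ℓ`.) §1.1.4 (p0004): "**Theorem 1.** Let `p > 3` be a prime such
that (sur) and (manin) both hold. Then the following are equivalent: (i) `𝓜_∞(δ) = ord_p(Tam_E)`, and hence
Conjecture 2 holds. (ii) The Iwasawa Main Conjecture (conj:IMC-det) for `ℚ_∞/ℚ` holds." and "The Iwasawa
Main Conjecture (conj:IMC-det) for `ℚ_∞/ℚ` in the above results is a reformulation of [kato-euler-systems]
in terms of determinants of arithmetic complexes." §2.2 (p0009), Prop. 2.2.3: "Conjecture (conj:IMC-det)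
holds if and only if `char_Λ(H¹(ℤ_S, 𝕋)/Λ·z_∞^{(S)}) = char_Λ(H²(ℤ_S, 𝕋))` as ideals in `Λ`" ("the Iwasawa
Main Conjecture formulated by Kato"); proof of (i) ⟹ (ii): §2.4 (p0010 L64 – p0011 L13). ANY reduction
type of `E` at `p` (§1, p0003: "allowing `E` to have any reduction type at `p`").

## Transcription (weaker than print; flags for the referee)

Frame = that of the PUBLISHED companion `Kim2026.thm111_katoMainIdentity_of_kuriharaNumber_ne_zero` and of
the package fact `Kobayashi2003.thm62_63_73_signedColemanKato_zeta`: `W/ℚ` globally minimal (structure facts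
of `T_pW` as instance BINDERS), `p` GOOD with `a_p = 0` (the preprint allows any reduction; the reading on
the `η = 1` SIGNED package needs good supersingular — weaker than print), a newform `f` of `W` (any level),
the period ratio `ϖ` (`ϖ·Ω(W) = Ω⁺_f`), the cyclotomic `κ` with generator `γ` matching the cyclotomic
variable. Castella–Sano's standing hypotheses: `5 ≤ p` («`p > 3`»); `¬ W.HasCM` («without complex
multiplication»); (sur) as `W.HasSurjectiveModNGaloisRep p`; (manin) as the period-transfer clause
`Ω(W) = u·Ω⁺_f`, `u ∈ ℚ`, `|u|_p = 1` (reading `KR-period`: the tree's rendering of «Manin constant prime to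
`p`» in every Kim-type fact at a semi-stable prime — `Kim2022_rankZero_padicValRat_sha_of_kuriharaNumber_ne_zero`,
the companion fact; at a good `p ≥ 5` with `E[p]` irreducible it is the named fact
`realPeriodRat_eq_unit_mul_plusPeriod`, Mazur 1978 Cor. 4.1 + Greenberg–Vatsal 2000 Rem. 3.4, which is
exactly the parenthesis after (manin) in the source). HYPOTHESIS (i) in the tree's vocabulary:
`kuriharaPartialInfty W p f = ord_p(W.tamagawaProduct)` — Kim's `∂^{(∞)}(δ̃)` over the CYCLIC Kolyvagin
levels of the `Ω⁺_f`-normalised collection (`KuriharaNumberInvariants`; reading `KR-cyclic-levels`, the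
reading of the accepted binders `BSTW921c_CastellaSano2026_kimTamagawaDefect_OPEN` and
`CastellaSano2026_thm1_via_kobayashi74_OPEN`: `X4.KimTamagawaDefectAt W p f` unfolds to this equality; the
printed `𝓜_∞(δ)` runs over all levels of `𝒩` — flag `CS26-1-cyclic-levels`). CONCLUSION (ii), Kato's main
conjecture over `ℚ_∞`, read on the package EXACTLY as in the companion: for every sign `ε` and all pinned
`I : Kato2004.IwasawaH1Data W p κ γ`, `Y : W.FineSelmerDualData κ γ` there is a package datum
`d : Kobayashi2003.SignedColemanKatoData W p f ϖ κ γ ε I` with `Module.charIdeal Λ Y.X = Module.charIdeal Λ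
(I.H ⧸ d.Z)`. READING FLAGS: `CS26-1-eta1-zeta-line` (Castella–Sano's `Λ·z_∞^{(S)}` — the `S`-imprimitive
zeta element, Prop. 2.2.3, equivalent to Kato's formulation by their remark after Cor. 1 — read as the
package's finite-index `d.Z`; `H²(ℤ_S, 𝕋)` vs `Sel₀(ℚ_∞)^∨ ≅ 𝐇²(T)` (Kobayashi Prop. 7.1 ii)): the
(conj:IMC-det) ⟺ Kato equivalence is the preprint's own Prop. 2.2.3; not formalised), `CS26-1-package`
(existential `d` bundling the PUBLISHED package construction, as in the companion), `CS26-1-cyclic-levels`,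
`KR-period`. NEVER cite this `Prop` as a theorem; take it as an explicit hypothesis `(hCS : …)`.

What this binder is NOT: not Conjecture 2 / Kim's Conjecture 1.10 (no claim that the identity holds — that is
the line's pair of stubs `stub_kuriharaPartialInfty_le_tamagawa_X7` / `stub_tamagawa_le_kuriharaPartialInfty_X7`);
not the converse (ii) ⟹ (i); not Thm. 2 (good ordinary / square-free supersingular cases); not a statement at
`p = 3`; not Kobayashi's signed main conjecture (derived Summits-side by the kernel Thm. 7.4).

## References

* F. Castella, T. Sano, arXiv:2601.14504 (2026): §1.1.1–1.1.4 with Conj. 2, Thm. 1, Cor. 1 (PDF pp. 3–4),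
  §2.2 Conj. 2.2.2, Prop. 2.2.3, Remark 2.2.4 (PDF p. 9), §2.4 (PDF pp. 10–11). [CastellaSano2026]
* C.-H. Kim, Amer. J. Math. 148 (2026) = arXiv:2203.12159: Conj. 1.10 (PDF p. 8), §1.5.1, Remark 6.2.
  [Kim2022StructureSelmer]
* S. Kobayashi, Invent. Math. 152 (2003): §5 (p. 10), Prop. 7.1 ii) (p. 12), proof of Thm. 7.4 (p. 13). [Kobayashi2003]
* K. Kato, Astérisque 295 (2004): §12.2, Thm. 12.5–12.6, Conj. 12.10. [Kato2004Asterisque]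
* B. Mazur, Invent. Math. 44 (1978), Cor. 4.1; R. Greenberg, V. Vatsal, Invent. Math. 142 (2000), §3 Rem. 3.4.
  [Mazur1978] [GreenbergVatsal2000]
-/

noncomputable section

open scoped Classical MatrixGroups ModularForm

open CongruenceSubgroup WeierstrassCurve Field Literature.NumberTheory.EllipticCurves
  Literature.NumberTheory.EllipticCurves.ModularForms Literature.NumberTheory.GaloisRepresentations

namespace Literature.NumberTheory.EllipticCurves.CastellaSano2026

/-- **OPEN HYPOTHESIS — UNREFEREED PREPRINT (Castella–Sano, arXiv:2601.14504, 2026), Thm. 1 (i) ⟹ (ii) at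
the trivial character, read on Kobayashi's `η = 1` Coleman/Kato package.** Source: "Theorem 1. Let `p > 3` be
a prime such that (sur) and (manin) both hold. Then the following are equivalent: (i) `𝓜_∞(δ) =
ord_p(Tam_E)` … (ii) The Iwasawa Main [C] for `ℚ_∞/ℚ` holds" (PDF p. 4; `E/ℚ` non-CM, §1.1.1; (ii) =
Kato's main identity `char_Λ(H¹(ℤ_S,𝕋)/Λz_∞^{(S)}) = char_Λ(H²(ℤ_S,𝕋))`, Prop. 2.2.3; any reduction type at `p`). TRANSCRIBED on the frame of the published
companion `Kim2026.thm111_katoMainIdentity_of_kuriharaNumber_ne_zero`: `W/ℚ` globally minimal, `5 ≤ p`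
GOOD with `a_p = 0` (weaker than print), a newform `f` of `W`, period ratio `ϖ` (`ϖ·Ω(W) = Ω⁺_f`), cyclotomic
`(κ, γ)` matching the variable; `¬ W.HasCM`; (sur) `W.HasSurjectiveModNGaloisRep p`; (manin) as the period
transfer `Ω(W) = u·Ω⁺_f`, `|u|_p = 1` (reading `KR-period`); (i) as Kim's Tamagawa-defect identity over the
cyclic levels of the `Ω⁺_f`-normalised collection, `kuriharaPartialInfty W p f = ord_p(W.tamagawaProduct)`
(reading `CS26-1-cyclic-levels`) ⟹ (ii) read on the package: for every sign `ε`, all pinned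
`I : Kato2004.IwasawaH1Data W p κ γ`, `Y : W.FineSelmerDualData κ γ`, some package datum `d` (Kobayashi Thm.
6.2/6.3/7.3 i) + Kato 12.6 at `η = 1`) has `Module.charIdeal Λ Y.X = Module.charIdeal Λ (I.H ⧸ d.Z)`
(readings `CS26-1-eta1-zeta-line`, `CS26-1-package`; module docstring). NEVER cite this `Prop` as a theorem
(FRESHNESS 2026-08-28: arXiv v1 only); take it as an explicit hypothesis. Nothing asserted.
[claim: CastellaSano2026, status: under-review]
[cite: Kobayashi2003, §5 (p. 10), Prop. 7.1 ii) (p. 12), proof of Thm. 7.4 (p. 13)]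
[cite: Kim2022StructureSelmer, §1.5.3 (PDF p. 8), §1.5.1 (PDF p. 7)] -/
def thm1_katoMainIdentity_of_kimTamagawaDefect_OPEN : Prop :=
  ∀ (W : WeierstrassCurve ℚ) [W.IsElliptic] [W.IsGloballyMinimal] (p : ℕ) [Fact p.Prime]
    [ContinuousSMul ℤ_[p] (W.tateModule p)] [Module.Free ℤ_[p] (W.tateModule p)]
    [Module.Finite ℤ_[p] (W.tateModule p)]
    {N : ℕ} [NeZero N] (f : CuspForm (Gamma0 N) 2) (ϖ : ℚ)
    (κ : ZpExtension ℚ p) (γ : absoluteGaloisGroup ℚ),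
  -- the frame of Kobayashi's `η = 1` package, at `p ≥ 5`
    5 ≤ p → W.HasGoodReductionAtPrime p → W.frobeniusTrace p = 0 → IsNewformOf W f →
    (ϖ : ℝ) * W.realPeriodRat = plusPeriod f →
    κ.IsCyclotomic → κ.IsTopGenerator γ → IsCyclotomicVariable p γ →
  -- Castella–Sano's standing hypotheses: non-CM, (sur), (manin) as the period transfer
    ¬ W.HasCM → W.HasSurjectiveModNGaloisRep p →
    (∃ u : ℚ, ‖(u : ℚ_[p])‖ = 1 ∧ W.realPeriodRat = u * plusPeriod f) →
  -- (i): Kim's Tamagawa-defect identity `∂^{(∞)}(δ̃) = ord_p Tam_E` (cyclic levels)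
    kuriharaPartialInfty W p f = (padicValNat p W.tamagawaProduct : ℕ∞) →
  -- (ii): Kato's main identity, read on the pinned objects through the `η = 1` package
  ∀ (ε : ℤˣ) (I : Kato2004.IwasawaH1Data W p κ γ) (Y : W.FineSelmerDualData κ γ),
    ∃ d : Kobayashi2003.SignedColemanKatoData W p f ϖ κ γ ε I,
      Module.charIdeal (IwasawaAlgebra p) Y.X =
        Module.charIdeal (IwasawaAlgebra p) (I.H ⧸ d.Z)

end Literature.NumberTheory.EllipticCurves.CastellaSano2026

end
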